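import Summits.AtomisticToContinuum.Crystallization.Theorems.ChargedEnergyGapRigidityDial
import Summits.AtomisticToContinuum.Crystallization.Theorems.ChargedEnergyGapPresentation
import Summits.AtomisticToContinuum.Crystallization.Theorems.ChargedEnergyGapExposedPricing
import Literature.MathematicalPhysics.StatisticalMechanics.CrystallizationSymmetries

/-!
# `PricedLinkCensus.ChargedEnergyGap` (stmt-AtomisticToContinuum-14231) — the DEEP-RIGIDITY split of the rigid residual
# (decomp-a2c lens 3 «one certified translation + split beneath», generation 44; part F-B, over part E `…RigidityDial` and part F-A)

Before this file (critic row 868): `[GC] CompactGrossGap θ ε R ⟺ IP ImprovablePricing … r η ∧ RP RigidPricing … r η` (part E),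
residual RP at `(3/20, 1/10, 6/5, 10, 1/100)`.  Caution (iii) of row 868: `Improvable` pins the lattice of periods, so RP contains
SHALLOW rigidity (a cell with no room is `(r, η)`-rigid although a roomy supercell presentation of the same point set is improvable).
Here the shallow part LEAVES the residual, with the transfer PROVED.
§1 `ImprovableAt` (site-free `Improvable`) is invariant under every period of the point SET (`improvableAt_add_iff`).  ★ `DeepImprovable r η Q x`:
   improvable in EVERY supercell presentation `kΛ_Q`, `k ≥ k₁(x)` (F-A `IsSupercell`) — the presentation-free content of improvability.
§2 Species / pieces: DIP `DeepImprovablePricing` (compact ∧ deeply improvable), DP `DeepPricing` (compact ∧ not); inside the rigid species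
   SRP `ShallowRigidPricing` (rigid ∧ deeply improvable: rigid ONLY for lack of room) / DRP `DeepRigidPricing` (rigid ∧ not deeply improvable).
   Exact splits `[GC] ⟺ DIP ∧ DP`, `RP ⟺ SRP ∧ DRP`; inclusions; dial ends; monotonicity.
§3 ★★ SUPERCELL TRANSFER `deepImprovablePricing_of_improvablePricing : IP → DIP` (PROVED, same `κ`): apply IP to ONE common supercell
   presentation `P` of `Q` (`k > max k₁`); «compact gross charged point of `Q.points`, improvable in `P`» is `Λ_Q`-invariant (F-A
   `compactGrossAt_add_period`, §1), is the improvable compact species of `P` on `F_P` (F-A `compactGrossAt_congr_points`) and contains the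
   deeply improvable compact species of `Q` on `F_Q`; F-A `card_mul_natCard_motif_eq_of_points_eq` makes the two counts proportional, as are
   the excesses.  Hence `SRP ⟸ DIP ⟸ IP` and ★★ `compactGrossGap_iff_improvable_deepRigid : [GC] ⟺ IP ∧ DRP`.
§4 ★★ `[G] GrossChargeGap (3/20) ⟺ IP ∧ DRP` at the record ([GE] = tree `exposedGrossPricing_record` p845344); FOUR-LEAF cones by name to
   `ChargedEnergyGap` at the record `(10, 1/100)` AND the alternate `(20, 1/100)` (row 868 (iv)), regime ends, the new dense residual
   `UniversalCompetitor (motifCompactDeepRigid …) (1/100)` (weaker than part E's by name) and the way back given IP.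
Tags.  DIP, SRP · WEAKER(proved) · PROVED FROM IP (not leaves).  DP · WEAKER(proved) · hull of DRP.  DRP `DeepRigidPricing (3/20) (1/10) (6/5)
10 (1/100)` · WEAKER than RP BY NAME (`deepRigidPricing_of_rigidPricing`; proper sub-species: the one site of primitive bcc is rigid, not
deep-rigid) · NEW RESIDUAL OF RECORD · UNDECIDED(test: census L3-RIG read for DEEP rigidity in roomy supercells; L3-NUC selects `r ∈ {10,
20}`) · INSTRUMENTABLE · IDEA-NEEDED (rigidity with incompatibility; total-frustration gap below nucleation) · BARRIER-ringed as RP.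
WHY NOVEL: part E's predicate was variational but pinned to a presentation; here the presentation is quotiented out and the quotient map
is a THEOREM (systems of representatives + one common supercell), not a tag.  WHY STRICTLY WEAKER: DIP, DP ⟸ [GC] and SRP, DRP ⟸ RP by
count inclusion (proved); DRP ↛ RP, DRP ↛ [GC], DP ↛ [GC] have no cheap proof (check/MustFail44.lean); DIP, SRP follow from IP (proved).
-/

noncomputable section

open scoped Classical
open Literature.MathematicalPhysics.StatisticalMechanics
open Literature.Geometry.DiscreteGeometry
open Summit.AtomisticToContinuum.Crystallization.Theses.PricedLinkCensus
open Summit.AtomisticToContinuum.Crystallization.Theorems.ChargedEnergyGapNegative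

namespace Summit.AtomisticToContinuum.Crystallization.Theorems.ChargedEnergyGapChartDial

/-! ## §1 Improvability at a point; deep improvability -/

/-- `Improvable`, read at a point of space (site-free form; same witness type: a same-lattice local modification gaining `η`). -/
def ImprovableAt (r η : ℝ) (Q : PeriodicConfiguration 3) (p : E3) : Prop :=
  ∃ Q' : PeriodicConfiguration 3, LocalMod r Q Q' p ∧ excess Q' + η ≤ excess Q

/-- `Improvable` is `ImprovableAt` at the site (definitional). -/
theorem improvable_iff_improvableAt (r η : ℝ) (Q : PeriodicConfiguration 3) (x : Q.motif) :
    Improvable r η Q x ↔ ImprovableAt r η Q (x : E3) := Iff.rfl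

/-- Monotonicity of `ImprovableAt` (radius up, gain down). -/
theorem ImprovableAt.mono {r r' η η' : ℝ} (hr : r ≤ r') (hη : η' ≤ η) {Q : PeriodicConfiguration 3} {p : E3}
    (h : ImprovableAt r η Q p) : ImprovableAt r' η' Q p := by
  obtain ⟨Q', hm, he⟩ := h
  exact ⟨Q', hm.mono hr, by linarith⟩

/-- Dial end: a non-positive gain is always available (`Q' := Q`). -/
theorem improvableAt_of_nonpos {r η : ℝ} (hη : η ≤ 0) (Q : PeriodicConfiguration 3) (p : E3) : ImprovableAt r η Q p :=
  ⟨Q, localMod_refl r Q p, by linarith⟩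

/-- The excess is translation invariant. -/
theorem excess_translate (Q : PeriodicConfiguration 3) (v : E3) : excess (Q.translate v) = excess Q := by
  simp only [excess, PeriodicConfiguration.card_motif_translate, PeriodicConfiguration.energyPerParticle_translate]

/-- Improvability at a point is transported along every period `g` of the point SET (translate the witness by `g`). -/
theorem improvableAt_add_of_setPeriod {r η : ℝ} {Q : PeriodicConfiguration 3} {g : E3}
    (hg : ∀ q : E3, q + g ∈ Q.points ↔ q ∈ Q.points) {p : E3} (h : ImprovableAt r η Q p) : ImprovableAt r η Q (p + g) := by
  obtain ⟨Q', ⟨hlat, hloc⟩, hex⟩ := h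
  refine ⟨Q'.translate g, ⟨by rw [PeriodicConfiguration.lattice_translate, hlat], fun q => ?_⟩, by rwa [excess_translate]⟩
  rcases hloc (q - g) with hq | ⟨g', hg', hd⟩
  · left
    rw [PeriodicConfiguration.mem_points_translate, ← hq, ← hg (q - g), sub_add_cancel]
  · right
    refine ⟨g', hg', ?_⟩
    have h1 : dist q (p + g + g') = dist (q - g) (p + g') := by
      rw [dist_eq_norm, dist_eq_norm]; congr 1; abel
    rwa [h1]

/-- ★ Improvability at a point is invariant under every period of the point set. -/
theorem improvableAt_add_iff {r η : ℝ} {Q : PeriodicConfiguration 3} {g : E3}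
    (hg : ∀ q : E3, q + g ∈ Q.points ↔ q ∈ Q.points) (p : E3) : ImprovableAt r η Q (p + g) ↔ ImprovableAt r η Q p := by
  refine ⟨fun h => ?_, improvableAt_add_of_setPeriod hg⟩
  have hg' : ∀ q : E3, q + -g ∈ Q.points ↔ q ∈ Q.points := fun q => by
    rw [← hg (q + -g), neg_add_cancel_right]
  have h1 := improvableAt_add_of_setPeriod hg' h
  rwa [add_neg_cancel_right] at h1

/-- ★ **DEEPLY `(r, η)`-IMPROVABLE motif site**: for all `k ≥ k₁` and every presentation `P` of `Q.points` with periods `kΛ_Q`, some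
same-lattice local modification of `P` within `r` of the `kΛ_Q`-orbit of `x` gains `η`.  Its negation is DEEP RIGIDITY. -/
def DeepImprovable (r η : ℝ) (Q : PeriodicConfiguration 3) (x : Q.motif) : Prop :=
  ∃ k₁ : ℕ, 0 < k₁ ∧ ∀ k : ℕ, k₁ ≤ k → ∀ P : PeriodicConfiguration 3, IsSupercell k Q P → ImprovableAt r η P (x : E3)

/-- Monotonicity of deep improvability (radius up, gain down). -/
theorem DeepImprovable.mono {r r' η η' : ℝ} (hr : r ≤ r') (hη : η' ≤ η) {Q : PeriodicConfiguration 3} {x : Q.motif}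
    (h : DeepImprovable r η Q x) : DeepImprovable r' η' Q x := by
  obtain ⟨k₁, hk₁, hk⟩ := h
  exact ⟨k₁, hk₁, fun k hkk P hP => (hk k hkk P hP).mono hr hη⟩

/-- Dial end: with a non-positive gain every site is deeply improvable. -/
theorem deepImprovable_of_nonpos {r η : ℝ} (hη : η ≤ 0) (Q : PeriodicConfiguration 3) (x : Q.motif) : DeepImprovable r η Q x :=
  ⟨1, Nat.one_pos, fun _ _ P _ => improvableAt_of_nonpos hη P _⟩

/-! ## §2 The four species, the pieces, the exact splits -/

/-- Number of compact gross charged motif sites that are deeply `(r, η)`-improvable. -/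
def motifCompactDeepImprovable (θ ε R r η : ℝ) (Q : PeriodicConfiguration 3) : ℕ :=
  Nat.card {x : Q.motif // ((Charged Q x ∧ ¬ ChartedAt θ Q (pt Q x)) ∧ ¬ Exposed ε R Q x) ∧ DeepImprovable r η Q x}

/-- Number of compact gross charged motif sites that are NOT deeply `(r, η)`-improvable (the deep hull of the residual). -/
def motifCompactDeep (θ ε R r η : ℝ) (Q : PeriodicConfiguration 3) : ℕ :=
  Nat.card {x : Q.motif // ((Charged Q x ∧ ¬ ChartedAt θ Q (pt Q x)) ∧ ¬ Exposed ε R Q x) ∧ ¬ DeepImprovable r η Q x}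

/-- Number of SHALLOW-RIGID compact gross charged motif sites: `(r, η)`-rigid in the presentation `Q` but deeply improvable. -/
def motifCompactShallow (θ ε R r η : ℝ) (Q : PeriodicConfiguration 3) : ℕ :=
  Nat.card {x : Q.motif //
    (((Charged Q x ∧ ¬ ChartedAt θ Q (pt Q x)) ∧ ¬ Exposed ε R Q x) ∧ ¬ Improvable r η Q x) ∧ DeepImprovable r η Q x}

/-- Number of DEEP-RIGID compact gross charged motif sites: `(r, η)`-rigid in `Q` and not deeply improvable — the residual species. -/
def motifCompactDeepRigid (θ ε R r η : ℝ) (Q : PeriodicConfiguration 3) : ℕ :=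
  Nat.card {x : Q.motif //
    (((Charged Q x ∧ ¬ ChartedAt θ Q (pt Q x)) ∧ ¬ Exposed ε R Q x) ∧ ¬ Improvable r η Q x) ∧ ¬ DeepImprovable r η Q x}

/-- compact = deep + deeply improvable. -/
theorem motifGrossCompact_eq_deep_add_deepImprovable (θ ε R r η : ℝ) (Q : PeriodicConfiguration 3) :
    motifGrossCompact θ ε R Q = motifCompactDeep θ ε R r η Q + motifCompactDeepImprovable θ ε R r η Q :=
  natCard_subtype_split (fun x : Q.motif => (Charged Q x ∧ ¬ ChartedAt θ Q (pt Q x)) ∧ ¬ Exposed ε R Q x)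
    (fun x => DeepImprovable r η Q x)

/-- rigid = deep-rigid + shallow-rigid. -/
theorem motifCompactRigid_eq_deepRigid_add_shallow (θ ε R r η : ℝ) (Q : PeriodicConfiguration 3) :
    motifCompactRigid θ ε R r η Q = motifCompactDeepRigid θ ε R r η Q + motifCompactShallow θ ε R r η Q :=
  natCard_subtype_split
    (fun x : Q.motif => ((Charged Q x ∧ ¬ ChartedAt θ Q (pt Q x)) ∧ ¬ Exposed ε R Q x) ∧ ¬ Improvable r η Q x)
    (fun x => DeepImprovable r η Q x)

/-- Shallow-rigid sites are deeply improvable compact sites. -/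
theorem motifCompactShallow_le_deepImprovable (θ ε R r η : ℝ) (Q : PeriodicConfiguration 3) :
    motifCompactShallow θ ε R r η Q ≤ motifCompactDeepImprovable θ ε R r η Q :=
  Nat.card_le_card_of_injective (fun x => ⟨x.1, x.2.1.1, x.2.2⟩) fun _ _ hab => Subtype.ext (Subtype.mk.inj hab)

/-- Deep-rigid sites are deep compact sites. -/
theorem motifCompactDeepRigid_le_deep (θ ε R r η : ℝ) (Q : PeriodicConfiguration 3) :
    motifCompactDeepRigid θ ε R r η Q ≤ motifCompactDeep θ ε R r η Q :=
  Nat.card_le_card_of_injective (fun x => ⟨x.1, x.2.1.1, x.2.2⟩) fun _ _ hab => Subtype.ext (Subtype.mk.inj hab)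

/-- Deep-rigid sites are rigid sites. -/
theorem motifCompactDeepRigid_le_rigid (θ ε R r η : ℝ) (Q : PeriodicConfiguration 3) :
    motifCompactDeepRigid θ ε R r η Q ≤ motifCompactRigid θ ε R r η Q := by
  rw [motifCompactRigid_eq_deepRigid_add_shallow]; exact Nat.le_add_right _ _

/-- piece DIP · WEAKER(proved) · PROVED FROM IP (`deepImprovablePricing_of_improvablePricing`) — not a leaf.
**Deeply-improvable pricing**: `κ` per compact gross charged motif site that is deeply `(r, η)`-improvable. -/
def DeepImprovablePricing (θ ε R r η : ℝ) : Prop :=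
  ∃ κ : ℝ, 0 < κ ∧ ∀ Q : PeriodicConfiguration 3, κ * (motifCompactDeepImprovable θ ε R r η Q : ℝ) ≤ excess Q

/-- piece DP · WEAKER(proved `deepPricing_of_compactGrossGap`) · deep HULL of the residual (`DRP ⟸ DP`, `[GC] ⟺ IP ∧ DP`).
**Deep pricing**: `κ` per compact gross charged motif site that is not deeply `(r, η)`-improvable. -/
def DeepPricing (θ ε R r η : ℝ) : Prop :=
  ∃ κ : ℝ, 0 < κ ∧ ∀ Q : PeriodicConfiguration 3, κ * (motifCompactDeep θ ε R r η Q : ℝ) ≤ excess Q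

/-- piece SRP · WEAKER(proved) · PROVED FROM IP (`shallowRigidPricing_of_improvablePricing`): shallow rigidity LEAVES the residual.
**Shallow-rigid pricing**: `κ` per compact gross charged motif site that is `(r, η)`-rigid in `Q` but deeply improvable. -/
def ShallowRigidPricing (θ ε R r η : ℝ) : Prop :=
  ∃ κ : ℝ, 0 < κ ∧ ∀ Q : PeriodicConfiguration 3, κ * (motifCompactShallow θ ε R r η Q : ℝ) ≤ excess Q

/-- piece DRP · WEAKER than RP BY NAME (proved `deepRigidPricing_of_rigidPricing`; proper sub-species) · NEW RESIDUAL OF RECORD of the gross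
side (`[GC] ⟺ IP ∧ DRP`) · UNDECIDED(test: census L3-RIG for DEEP rigidity in roomy supercells — relaxed dislocation dipole arrays, grain
boundaries (topological protection); tcp / bcc / sc bulk expected deeply improvable beyond its nucleation radius, L3-NUC selects `r`) ·
INSTRUMENTABLE · IDEA-NEEDED (rigidity with incompatibility, Read–Shockley / Lauteri–Luckhaus arXiv:1608.06155 over the P-side chart frames;
total-frustration gap below nucleation) · BARRIER-ringed (TetrahedralFrustration for the sub-nucleation part; LocalCertificateBarrier not sharp).
**Deep-rigid pricing**: `κ` per compact gross charged motif site that is `(r, η)`-rigid in `Q` and not deeply `(r, η)`-improvable. -/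
def DeepRigidPricing (θ ε R r η : ℝ) : Prop :=
  ∃ κ : ℝ, 0 < κ ∧ ∀ Q : PeriodicConfiguration 3, κ * (motifCompactDeepRigid θ ε R r η Q : ℝ) ≤ excess Q

/-- **THE DEEP SPLIT OF THE COMPACT GAP IS EXACT**: `[GC] ⟺ DIP ∧ DP` for every `θ ε R r η`. -/
theorem compactGrossGap_iff_deepImprovable_deep (θ ε R r η : ℝ) :
    CompactGrossGap θ ε R ↔ DeepImprovablePricing θ ε R r η ∧ DeepPricing θ ε R r η := by
  rw [compactGrossGap_iff_speciesPricing,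
    speciesPricing_congr (c' := fun Q => motifCompactDeepImprovable θ ε R r η Q + motifCompactDeep θ ε R r η Q)
      (fun Q => by rw [motifGrossCompact_eq_deep_add_deepImprovable θ ε R r η Q, add_comm]),
    speciesPricing_add_iff]
  exact Iff.rfl

/-- **THE DEEP SPLIT OF THE RIGID RESIDUAL IS EXACT**: `RP ⟺ SRP ∧ DRP` for every `θ ε R r η`. -/
theorem rigidPricing_iff_shallow_deepRigid (θ ε R r η : ℝ) :
    RigidPricing θ ε R r η ↔ ShallowRigidPricing θ ε R r η ∧ DeepRigidPricing θ ε R r η := by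
  rw [rigidPricing_iff_speciesPricing,
    speciesPricing_congr (c' := fun Q => motifCompactShallow θ ε R r η Q + motifCompactDeepRigid θ ε R r η Q)
      (fun Q => by rw [motifCompactRigid_eq_deepRigid_add_shallow θ ε R r η Q, add_comm]),
    speciesPricing_add_iff]
  exact Iff.rfl

/-- DIP is weaker than the compact gap. -/
theorem deepImprovablePricing_of_compactGrossGap {θ ε R : ℝ} (r η : ℝ) (h : CompactGrossGap θ ε R) :
    DeepImprovablePricing θ ε R r η :=
  ((compactGrossGap_iff_deepImprovable_deep θ ε R r η).1 h).1

/-- DP is weaker than the compact gap. -/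
theorem deepPricing_of_compactGrossGap {θ ε R : ℝ} (r η : ℝ) (h : CompactGrossGap θ ε R) : DeepPricing θ ε R r η :=
  ((compactGrossGap_iff_deepImprovable_deep θ ε R r η).1 h).2

/-- SRP is weaker than RP. -/
theorem shallowRigidPricing_of_rigidPricing {θ ε R r η : ℝ} (h : RigidPricing θ ε R r η) : ShallowRigidPricing θ ε R r η :=
  ((rigidPricing_iff_shallow_deepRigid θ ε R r η).1 h).1

/-- ★ DRP is weaker than RP (by name: the deep-rigid species is part of the rigid species). -/
theorem deepRigidPricing_of_rigidPricing {θ ε R r η : ℝ} (h : RigidPricing θ ε R r η) : DeepRigidPricing θ ε R r η :=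
  ((rigidPricing_iff_shallow_deepRigid θ ε R r η).1 h).2

/-- DRP is weaker than its hull DP. -/
theorem deepRigidPricing_of_deepPricing {θ ε R r η : ℝ} (h : DeepPricing θ ε R r η) : DeepRigidPricing θ ε R r η :=
  SpeciesPricing.mono h (motifCompactDeepRigid_le_deep θ ε R r η)

/-- SRP is weaker than DIP (shallow-rigid sites are deeply improvable). -/
theorem shallowRigidPricing_of_deepImprovablePricing {θ ε R r η : ℝ} (h : DeepImprovablePricing θ ε R r η) :
    ShallowRigidPricing θ ε R r η :=
  SpeciesPricing.mono h (motifCompactShallow_le_deepImprovable θ ε R r η)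

/-- DRP is weaker than the compact gap. -/
theorem deepRigidPricing_of_compactGrossGap {θ ε R : ℝ} (r η : ℝ) (h : CompactGrossGap θ ε R) : DeepRigidPricing θ ε R r η :=
  deepRigidPricing_of_rigidPricing (rigidPricing_of_compactGrossGap r η h)

/-- Dial end: at `η ≤ 0` there are no deep sites. -/
theorem motifCompactDeep_eq_zero_of_nonpos {θ ε R r η : ℝ} (hη : η ≤ 0) (Q : PeriodicConfiguration 3) :
    motifCompactDeep θ ε R r η Q = 0 := by
  rw [motifCompactDeep, Nat.card_eq_zero]
  exact Or.inl ⟨fun x => x.2.2 (deepImprovable_of_nonpos hη Q x.1)⟩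

/-- Dial end: DP (hence DRP) at `η ≤ 0`. -/
theorem deepPricing_of_nonpos {θ ε R r η : ℝ} (hη : η ≤ 0) : DeepPricing θ ε R r η :=
  ⟨1, one_pos, fun Q => by rw [motifCompactDeep_eq_zero_of_nonpos hη]; simpa using excess_nonneg' Q⟩

/-- Dial end: DRP at `η ≤ 0`. -/
theorem deepRigidPricing_of_nonpos {θ ε R r η : ℝ} (hη : η ≤ 0) : DeepRigidPricing θ ε R r η :=
  deepRigidPricing_of_deepPricing (deepPricing_of_nonpos hη)

/-- Monotonicity of the deep count (fewer deep sites for a larger radius and a smaller gain). -/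
theorem motifCompactDeep_anti {θ ε R r r' η η' : ℝ} (hr : r ≤ r') (hη : η' ≤ η) (Q : PeriodicConfiguration 3) :
    motifCompactDeep θ ε R r' η' Q ≤ motifCompactDeep θ ε R r η Q :=
  Nat.card_le_card_of_injective (fun x => ⟨x.1, x.2.1, fun h => x.2.2 (h.mono hr hη)⟩)
    fun _ _ hab => Subtype.ext (Subtype.mk.inj hab)

/-- Monotonicity of the deep-rigid count. -/
theorem motifCompactDeepRigid_anti {θ ε R r r' η η' : ℝ} (hr : r ≤ r') (hη : η' ≤ η) (Q : PeriodicConfiguration 3) :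
    motifCompactDeepRigid θ ε R r' η' Q ≤ motifCompactDeepRigid θ ε R r η Q :=
  Nat.card_le_card_of_injective
    (fun x => ⟨x.1, ⟨x.2.1.1, fun h => x.2.1.2 (h.mono hr hη)⟩, fun h => x.2.2 (h.mono hr hη)⟩)
    fun _ _ hab => Subtype.ext (Subtype.mk.inj hab)

/-- **Monotonicity of the residual**: DRP gets WEAKER as the radius grows and the required gain shrinks. -/
theorem deepRigidPricing_mono {θ ε R r r' η η' : ℝ} (hr : r ≤ r') (hη : η' ≤ η) (h : DeepRigidPricing θ ε R r η) :
    DeepRigidPricing θ ε R r' η' :=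
  SpeciesPricing.mono h (motifCompactDeepRigid_anti hr hη)

/-! ## §3 ★★ The supercell transfer: IP prices the deeply improvable sites -/

/-- ★★ **SUPERCELL TRANSFER** (PROVED): improvable pricing implies deeply-improvable pricing, with the same constant. -/
theorem deepImprovablePricing_of_improvablePricing {θ ε R r η : ℝ} (h : ImprovablePricing θ ε R r η) :
    DeepImprovablePricing θ ε R r η := by
  obtain ⟨κ, hκ, hIP⟩ := h
  refine ⟨κ, hκ, fun Q => ?_⟩
  -- a common supercell size for the finitely many deeply improvable compact sites of `Q`
  set T := {x : Q.motif // ((Charged Q x ∧ ¬ ChartedAt θ Q (pt Q x)) ∧ ¬ Exposed ε R Q x) ∧ DeepImprovable r η Q x} with hT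
  choose k₁ hk₁pos hk₁ using fun x : T => x.2.2
  obtain ⟨M, hM⟩ := Finite.bddAbove_range k₁
  have hMk : ∀ x : T, k₁ x ≤ M + 1 := fun x => (hM ⟨x, rfl⟩).trans (Nat.le_succ M)
  obtain ⟨P, hP, hE⟩ := exists_isSupercell Q (Nat.succ_pos M)
  -- the `Λ_Q`-invariant predicate «compact gross charged point of `Q.points`, improvable in `P`»
  have hper : ∀ g ∈ Q.lattice, ∀ q : E3, q + g ∈ P.points ↔ q ∈ P.points := fun g hg q => by
    rw [hP.1]; exact add_mem_points_iff Q hg q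
  set S : E3 → Prop := fun p => CompactGrossAt θ ε R Q p ∧ ImprovableAt r η P p with hS
  have hSQ : ∀ p, ∀ g ∈ Q.lattice, (S (p + g) ↔ S p) := fun p g hg =>
    and_congr (compactGrossAt_add_period θ ε R Q hg p) (improvableAt_add_iff (hper g hg) p)
  have hSP : ∀ p, ∀ g ∈ P.lattice, (S (p + g) ↔ S p) := fun p g hg => hSQ p g (hP.mem_lattice hg)
  -- (1) the deeply improvable compact sites of `Q` satisfy `S` (they are improvable in `P` since `M + 1 ≥ k₁`)
  have h1 : Nat.card T ≤ Nat.card {x : Q.motif // S x} :=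
    Nat.card_le_card_of_injective
      (fun x => ⟨x.1, (compactGrossAt_coe_iff θ ε R Q x.1).2 x.2.1, hk₁ x (M + 1) (hMk x) P hP⟩)
      fun _ _ hab => Subtype.ext (Subtype.mk.inj hab)
  -- (2) on `F_P`, `S` is the improvable compact species of `P`
  have h2 : Nat.card {x : P.motif // S x} = motifCompactImprovable θ ε R r η P :=
    Nat.card_congr (Equiv.subtypeEquivRight fun x =>
      and_congr ((compactGrossAt_congr_points θ ε R hP.1 (x : E3)).symm.trans (compactGrossAt_coe_iff θ ε R P x))
        (improvable_iff_improvableAt r η P x).symm)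
  -- (3) proportional counts and excesses, and IP at `P`
  have h3 := card_mul_natCard_motif_eq_of_points_eq P Q hP.1 hSP hSQ
  have h4 := card_mul_excess_eq P Q hE
  have hIPP : κ * (Nat.card {x : P.motif // S x} : ℝ) ≤ excess P := by rw [h2]; exact hIP P
  have hFP : (0 : ℝ) < P.motif.card := by exact_mod_cast P.motif_nonempty.card_pos
  have h5 : (P.motif.card : ℝ) * (κ * Nat.card {x : Q.motif // S x}) ≤ (P.motif.card : ℝ) * excess Q :=
    calc (P.motif.card : ℝ) * (κ * Nat.card {x : Q.motif // S x})
        = κ * ((P.motif.card : ℝ) * Nat.card {x : Q.motif // S x}) := by ring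
      _ = κ * ((Q.motif.card : ℝ) * Nat.card {x : P.motif // S x}) := by rw [h3]
      _ = (Q.motif.card : ℝ) * (κ * Nat.card {x : P.motif // S x}) := by ring
      _ ≤ (Q.motif.card : ℝ) * excess P := mul_le_mul_of_nonneg_left hIPP (Nat.cast_nonneg _)
      _ = (P.motif.card : ℝ) * excess Q := h4
  have h6 : κ * (Nat.card {x : Q.motif // S x} : ℝ) ≤ excess Q := le_of_mul_le_mul_left h5 hFP
  exact (mul_le_mul_of_nonneg_left (Nat.cast_le.2 h1) hκ.le).trans h6

/-- ★ SRP is a consequence of IP: shallow-rigid sites leave the residual at no cost. -/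
theorem shallowRigidPricing_of_improvablePricing {θ ε R r η : ℝ} (h : ImprovablePricing θ ε R r η) :
    ShallowRigidPricing θ ε R r η :=
  shallowRigidPricing_of_deepImprovablePricing (deepImprovablePricing_of_improvablePricing h)

/-- ★ IP and DRP give back RP. -/
theorem rigidPricing_of_improvable_deepRigid {θ ε R r η : ℝ} (hI : ImprovablePricing θ ε R r η)
    (hD : DeepRigidPricing θ ε R r η) : RigidPricing θ ε R r η :=
  (rigidPricing_iff_shallow_deepRigid θ ε R r η).2 ⟨shallowRigidPricing_of_improvablePricing hI, hD⟩

/-- ★★ **THE LINE OF RECORD**: `[GC] ⟺ IP ∧ DRP` for every `θ ε R r η`. -/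
theorem compactGrossGap_iff_improvable_deepRigid (θ ε R r η : ℝ) :
    CompactGrossGap θ ε R ↔ ImprovablePricing θ ε R r η ∧ DeepRigidPricing θ ε R r η :=
  ⟨fun h => ⟨improvablePricing_of_compactGrossGap r η h, deepRigidPricing_of_compactGrossGap r η h⟩,
    fun h => compactGrossGap_of_improvable_rigid h.1 (rigidPricing_of_improvable_deepRigid h.1 h.2)⟩

/-- The hull form of the line: `[GC] ⟺ IP ∧ DP`. -/
theorem compactGrossGap_iff_improvable_deep (θ ε R r η : ℝ) :
    CompactGrossGap θ ε R ↔ ImprovablePricing θ ε R r η ∧ DeepPricing θ ε R r η :=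
  ⟨fun h => ⟨improvablePricing_of_compactGrossGap r η h, deepPricing_of_compactGrossGap r η h⟩,
    fun h => (compactGrossGap_iff_improvable_deepRigid θ ε R r η).2 ⟨h.1, deepRigidPricing_of_deepPricing h.2⟩⟩

/-- Next to IP, the residual DRP and its hull DP are interchangeable. -/
theorem deepPricing_of_improvable_deepRigid {θ ε R r η : ℝ} (hI : ImprovablePricing θ ε R r η)
    (hD : DeepRigidPricing θ ε R r η) : DeepPricing θ ε R r η :=
  deepPricing_of_compactGrossGap r η ((compactGrossGap_iff_improvable_deepRigid θ ε R r η).2 ⟨hI, hD⟩)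

/-! ## §4 Cones by name, the two record nodes `(10, 1/100)` / `(20, 1/100)`, regime ends -/

/-- `ChargedEnergyGap` from the exposure piece, IP, DRP and the P-side. -/
theorem chargedEnergyGap_of_deepRigidity {θ ε R r η : ℝ} (hE : ExposedGrossPricing θ ε R) (hI : ImprovablePricing θ ε R r η)
    (hD : DeepRigidPricing θ ε R r η) (hP : ChartedChargePricing θ) : ChargedEnergyGap :=
  chargedEnergyGap_of_rigidityDial hE hI (rigidPricing_of_improvable_deepRigid hI hD) hP

/-- The regime dial on the residual: DRP ⟺ dense ∧ dilute, for every `φ₀`. -/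
theorem deepRigidPricing_iff_dense_dilute (θ ε R r η φ₀ : ℝ) :
    DeepRigidPricing θ ε R r η ↔
      DensePricing (motifCompactDeepRigid θ ε R r η) φ₀ ∧ DilutePricing (motifCompactDeepRigid θ ε R r η) φ₀ :=
  speciesPricing_iff_dense_dilute _ φ₀

/-- `ChargedEnergyGap` from the exposure piece, IP, the two regime ends of DRP and the P-side. -/
theorem chargedEnergyGap_of_deepRigidity_regime {θ ε R r η φ₀ : ℝ} (hE : ExposedGrossPricing θ ε R)
    (hI : ImprovablePricing θ ε R r η) (hU : UniversalCompetitor (motifCompactDeepRigid θ ε R r η) φ₀)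
    (hDil : DilutePricing (motifCompactDeepRigid θ ε R r η) φ₀) (hP : ChartedChargePricing θ) : ChargedEnergyGap :=
  chargedEnergyGap_of_deepRigidity hE hI
    ((deepRigidPricing_iff_dense_dilute θ ε R r η φ₀).2 ⟨densePricing_of_universalCompetitor hU, hDil⟩) hP

/-- ★★ **THE WHOLE GROSS SIDE AT THE RECORD**: `[G] GrossChargeGap (3/20) ⟺ IP ∧ DRP` at `(ε, R, r, η) = (1/10, 6/5, 10, 1/100)` (the
exposed piece [GE] is the tree's `exposedGrossPricing_record`, `…ChargedEnergyGapExposedPricing` p845344). -/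
theorem grossChargeGap_iff_improvable_deepRigid_record :
    GrossChargeGap (3 / 20) ↔
      ImprovablePricing (3 / 20) (1 / 10) (6 / 5) 10 (1 / 100) ∧ DeepRigidPricing (3 / 20) (1 / 10) (6 / 5) 10 (1 / 100) :=
  grossChargeGap_iff_compactGrossGap_record.trans (compactGrossGap_iff_improvable_deepRigid _ _ _ _ _)

/-- ★ **RECORD CONE `(r, η) = (10, 1/100)`**, FOUR leaves: `ChargedEnergyGap` from IP · UC(deep-rigid, dense) · DP(deep-rigid, dilute) ·
P-side at `(θ, ε, R, r, η, φ₀) = (3/20, 1/10, 6/5, 10, 1/100, 1/100)` ([GE] discharged by the tree). -/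
theorem chargedEnergyGap_of_deepRigidity_record (hI : ImprovablePricing (3 / 20) (1 / 10) (6 / 5) 10 (1 / 100))
    (hU : UniversalCompetitor (motifCompactDeepRigid (3 / 20) (1 / 10) (6 / 5) 10 (1 / 100)) (1 / 100))
    (hDil : DilutePricing (motifCompactDeepRigid (3 / 20) (1 / 10) (6 / 5) 10 (1 / 100)) (1 / 100))
    (hP : ChartedChargePricing (3 / 20)) : ChargedEnergyGap :=
  chargedEnergyGap_of_deepRigidity_regime exposedGrossPricing_record hI hU hDil hP

/-- ★ **ALTERNATE RECORD CONE `(r, η) = (20, 1/100)`** (critic row 868 (iv): the radius census L3-NUC may select). -/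
theorem chargedEnergyGap_of_deepRigidity_record20 (hI : ImprovablePricing (3 / 20) (1 / 10) (6 / 5) 20 (1 / 100))
    (hU : UniversalCompetitor (motifCompactDeepRigid (3 / 20) (1 / 10) (6 / 5) 20 (1 / 100)) (1 / 100))
    (hDil : DilutePricing (motifCompactDeepRigid (3 / 20) (1 / 10) (6 / 5) 20 (1 / 100)) (1 / 100))
    (hP : ChartedChargePricing (3 / 20)) : ChargedEnergyGap :=
  chargedEnergyGap_of_deepRigidity_regime exposedGrossPricing_record hI hU hDil hP

/-- Bridge between the two records on the residual: DRP at `r = 10` gives DRP at `r = 20`. -/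
theorem deepRigidPricing_record20_of_record (h : DeepRigidPricing (3 / 20) (1 / 10) (6 / 5) 10 (1 / 100)) :
    DeepRigidPricing (3 / 20) (1 / 10) (6 / 5) 20 (1 / 100) :=
  deepRigidPricing_mono (by norm_num) le_rfl h

/-- The new dense residual is weaker than part E's (antitonicity of the universal competitor in the species). -/
theorem universalCompetitor_deepRigid_of_rigid {θ ε R r η φ₀ : ℝ}
    (h : UniversalCompetitor (motifCompactRigid θ ε R r η) φ₀) : UniversalCompetitor (motifCompactDeepRigid θ ε R r η) φ₀ :=
  h.anti (motifCompactDeepRigid_le_rigid θ ε R r η)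

/-- ★ Record instance: part E's dense residual implies the new dense residual `UC(motifCompactDeepRigid (3/20)(1/10)(6/5) 10 (1/100)) (1/100)`. -/
theorem universalCompetitor_deepRigid_record
    (h : UniversalCompetitor (motifCompactRigid (3 / 20) (1 / 10) (6 / 5) 10 (1 / 100)) (1 / 100)) :
    UniversalCompetitor (motifCompactDeepRigid (3 / 20) (1 / 10) (6 / 5) 10 (1 / 100)) (1 / 100) :=
  universalCompetitor_deepRigid_of_rigid h

/-- The way back: with IP in hand the new residual returns part E's dense residual (nothing is lost). -/
theorem universalCompetitor_rigid_of_improvable_deepRigid {θ ε R r η φ₀ : ℝ} (hφ : 0 < φ₀)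
    (hI : ImprovablePricing θ ε R r η) (hD : DeepRigidPricing θ ε R r η) :
    UniversalCompetitor (motifCompactRigid θ ε R r η) φ₀ :=
  universalCompetitor_of_densePricing hφ
    ((rigidPricing_iff_dense_dilute θ ε R r η φ₀).1 (rigidPricing_of_improvable_deepRigid hI hD)).1

end Summit.AtomisticToContinuum.Crystallization.Theorems.ChargedEnergyGapChartDial

end
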